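import Summits.BirchSwinnertonDyer.BirchSwinnertonDyer.Theorems.SylvesterTwoHeegnerIndexUpperOffV0LevelOneIsotropy
import Summits.BirchSwinnertonDyer.BirchSwinnertonDyer.Theorems.SylvesterTwoHeegnerIndexUpperOffV0Conjugation
import Literature.NumberTheory.EllipticCurves.HeegnerPointsKolyvaginPrimaryProp82Proofs
import HarnessLib

/-!
# K7t crux `UpperOffV0HSYPlus` (item 19804): LEVEL-ONE RIGIDITY at a Kolyvagin prime from (R)_M —
# Gross's Claim 10.1 AT `p = 2`, local form, for `y² = x³ − c`

Route `SylvesterTwoHeegnerIndex` (cell bsd-cm, rung K7t), line `offv0-kolyvagin2`, k7t-c2 g7.  Galois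
wrapper of `EisensteinTorsion.tau_eq_self_of_two_torsion_of_pairing_eigen_eq_zero`
(`…UpperOffV0LevelOneIsotropy`) in EXACTLY the currency of k7t-c2 g4's
`lemma_5_3_descent_of_reciprocity_two` (`…UpperOffV0DualityTwo`; its Steps 0–7 and 10 re-run
verbatim): `d` a `ν`-eigenclass of FULL ORDER at `λ` (`2^{M-1} d` not Selmer-local: TYPE I), `s` a
Selmer class with `2s = 0` (`Sel₂(E/K) = S_q(E/K)[2]`, `E(K)[2] = 0`), (R)_M `e([s, F], [d, σ]) = 0`
(the shape of the registered stub (e)).  CONCLUSION: **`s − c_* s` is locally trivial at `λ`**.  With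
McCallum's Cor. 3.2 at `2` for the eigen pair `{δy_K, s − c_* s}` this is the input `hloc` of
`LevelOne.tau_eq_self_of_locTrivial_of_cebotarev` (`Sel₂(E/K)` pointwise fixed by complex
conjugation); by ISOTROPY / EXACTNESS (same file) (R)_M carries no further information on such
classes.  NOT the crux (B14 = O12 open as a class); no definition, no named fact, no sorry.
-/

noncomputable section
open scoped Classical Pointwise
open WeierstrassCurve NumberField IsDedekindDomain Field WithZero
open Literature.NumberTheory.GaloisRepresentations Literature.NumberTheory.EllipticCurves
  Literature.NumberTheory.EllipticCurves.KolyvaginReciprocity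

set_option autoImplicit false
set_option linter.dupNamespace false
namespace Summit.BirchSwinnertonDyer.BirchSwinnertonDyer.Theorems.SylvesterTwoUpper

universe u
variable {K : Type u} [Field K] [NumberField K] (W : WeierstrassCurve ℚ)

set_option maxHeartbeats 1600000 in
/-- **Gross's Claim 10.1 at `p = 2`, local form, from (R)_M at `λ`, for `y² = x³ − c`**: `K`
imaginary quadratic with conjugation `c`, `ℓ` a Kolyvagin prime of level `M` at `2`, good reduction
at `λ = (ℓ)`, `e` alternating left-non-degenerate on `E_{2^M}`, `d` a `ν`-eigenclass with `2^{M-1} d`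
not Selmer at `λ` (type I), `s ∈ S_{2^M}(E/K)` with `2s = 0`, (R)_M: `e([s, F], [d, σ]) = 0`; then
**`(s − c_* s)_λ = 0`**.  Steps 0–7, 10 of `lemma_5_3_descent_of_reciprocity_two` verbatim; Step 8–9:
`[s, τ']` is `2`-torsion and orthogonal to the full-order eigenvector `[d, σ₁]`, hence fixed by the
lift of `c`, and `[c_* s, τ'] = ι[s, τ']` (`IsLiftOfAut.h1Eval_conjAct`).
[cite: GrossLMS1991, §10 Claim 10.1, Prop. 8.2, (7.6), 9.6] [cite: McCallumLMS1991, §5 Lemma 5.3] -/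
theorem sub_conjAct_mem_torsionLocalKer_of_reciprocity_two [W.IsElliptic] (hK : IsImaginaryQuadratic K)
    {CW : VariableChange ℚ} {cW : ℚ} (hCW : CW • W = ⟨0, 0, 0, 0, -cW⟩)
    {c : K ≃ₐ[ℚ] K} (hc : c ≠ 1)
    {N ℓ : ℕ} (hℓ : IsKolyvaginPrime N W K 2 ℓ) {M : ℕ} (hM : 1 ≤ M) {q : ℕ} (hq : q = 2 ^ M)
    (hℓM : FrobEqFrobInfty W K q ℓ)
    (hgood : (W.baseChange K).HasGoodReductionAt hℓ.place)
    {A : Type*} [AddCommGroup A]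
    (e : geomTorsion (W.baseChange K) (q : ℤ) →+
      geomTorsion (W.baseChange K) (q : ℤ) →+ A)
    (halt : ∀ x, e x x = 0) (hnd : ∀ x, (∀ y, e x y = 0) → x = 0)
    {ν : ℤ} (hν : ν = 1 ∨ ν = -1)
    {d : galH1Torsion (W.baseChange K) (q : ℤ)}
    (hd : conjAct W c (q : ℤ) d = ν • d)
    (hdv : (((2 : ℕ) : ℤ) ^ (M - 1)) • d ∉
      selmerLocalKer (W.baseChange K) (hℓ.place.adicCompletion K) (q : ℤ))
    {s : galH1Torsion (W.baseChange K) (q : ℤ)}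
    (hs : s ∈ selmerGroup (W.baseChange K) (q : ℤ))
    (h2s : (2 : ℤ) • s = 0)
    (hR : ∀ 𝔔 ∈ hℓ.place.primesAbove, ∀ F : absoluteGaloisGroup K, IsArithFrobAt (𝓞 K) F 𝔔 →
      F ∈ torsionFixing (W.baseChange K) (q : ℤ) →
      ∀ σ ∈ 𝔔.inertia (absoluteGaloisGroup K),
      e (h1Eval (W.baseChange K) (q : ℤ) s F)
        (h1Eval (W.baseChange K) (q : ℤ) d σ) = 0) :
    s - conjAct W c (q : ℤ) s ∈
      (W.baseChange K).torsionLocalKer (hℓ.place.adicCompletion K) (q : ℤ) := by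
  classical
  haveI : Algebra.IsQuadraticExtension ℚ K := ⟨hK.1⟩
  haveI : IsTotallyComplex K := hK.2
  set w := hℓ.place with hwdef
  have hℓprime : ℓ.Prime := hℓ.prime
  have hq0 : q ≠ 0 := by rw [hq]; exact pow_ne_zero M two_ne_zero
  have hqpos : 0 < q := Nat.pos_of_ne_zero hq0
  have hq0Z : (q : ℤ) ≠ 0 := by exact_mod_cast hq0
  have hpw' : ((2 : ℕ) : 𝓞 K) ∉ w.asIdeal :=
    not_natCast_mem_of_prime_ne hℓprime Nat.prime_two hℓ.2.2.2.1 w hℓ.mem_place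
  have hqw' : (q : 𝓞 K) ∉ w.asIdeal := by
    rw [hq, Nat.cast_pow]; exact fun h ↦ hpw' (w.isPrime.mem_of_pow_mem M h)
  have hqw : (((q : ℕ) : ℤ) : 𝓞 K) ∉ w.asIdeal := by rwa [Int.cast_natCast]
  have hwbad : w ∉ (W.baseChange K).badPlaces (𝓞 K) := fun h ↦ h hgood
  have hπ : w.valuation K (ℓ : K) = exp (-1 : ℤ) := by
    have h1 : (ℓ : K) = algebraMap (𝓞 K) K (ℓ : 𝓞 K) := by simp
    rw [h1, HeightOneSpectrum.valuation_of_algebraMap]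
    exact w.intValuation_singleton (by exact_mod_cast hℓprime.ne_zero) rfl
  have hTq : ∀ P : geomTorsion (W.baseChange K) q, q • P = 0 := fun P ↦ by
    have := (mem_geomTorsion_iff (W.baseChange K) q _).mp P.2
    apply Subtype.ext; rw [AddSubgroupClass.coe_nsmul, ← natCast_zsmul]
    exact this
  have hcardK : Nat.card (geomTorsion (W.baseChange K) q) = q ^ 2 :=
    card_torsionPoints_eq_sq_holds (W.baseChange K) (AlgebraicClosure K)
      (by exact_mod_cast hq0)
  obtain ⟨v, 𝔓₀, h, c₀, hℓv, h𝔓₀, hh, hc₀, hE, hKact⟩ := hℓM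
  have hHi := index_range_absGaloisRestrict_eq_finrank ℚ K
  haveI hHn : ((absGaloisRestrict ℚ K).range).Normal :=
    Subgroup.normal_of_index_eq_two (hHi.trans hK.1)
  set e₀ : K →ₐ[ℚ] AlgebraicClosure ℚ := (absClosureEquiv ℚ K).symm.toAlgHom.comp
      (IsScalarTower.toAlgHom ℚ K (AlgebraicClosure K)) with he₀
  have he₀x : ∀ x : K, e₀ x = (absClosureEquiv ℚ K).symm (algebraMap K (AlgebraicClosure K) x) :=
    fun _ ↦ rfl
  have hrange : ∀ γ : absoluteGaloisGroup ℚ,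
      γ ∈ Set.range (absGaloisRestrict ℚ K) ↔ ∀ x : K, γ • e₀ x = e₀ x := fun γ ↦ by
    rw [mem_range_absGaloisRestrict_iff]
    refine forall_congr' fun x ↦ ?_
    rw [absGaloisTransport_apply, he₀x]
    constructor
    · intro h1
      apply (absClosureEquiv ℚ K).injective; rw [AlgEquiv.apply_symm_apply]
      exact h1
    · intro h1
      rw [h1, AlgEquiv.apply_symm_apply]
  have hc₀H : c₀ ∉ Set.range (absGaloisRestrict ℚ K) :=
    hc₀.not_mem_range_absGaloisRestrict (L := K) IsTotallyComplex.isComplex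
  have hhH : h ∉ (absGaloisRestrict ℚ K).range := by
    intro hmem
    have hmem' : h ∈ Set.range (absGaloisRestrict ℚ K) := hmem
    apply hc₀H; rw [hrange]
    intro x; rw [← hKact e₀ x]
    exact (hrange h).mp hmem' x
  have hunr : Algebra.IsUnramifiedIn (𝓞 K) v.asIdeal :=
    isUnramifiedIn_of_span_natCast_isPrime hℓprime hℓ.2.2.2.2.1 hℓv
  have hIr := inertia_le_range_absGaloisRestrict_of_isUnramifiedIn (K := K) hunr h𝔓₀
  obtain ⟨w', 𝔔, τ', hw'v, -, -, h𝔔w, h𝔔𝔓₀, hτ', hresτ'⟩ :=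
    exists_place_inert_of_not_mem_range (F := ℚ) (M := K) (hK.1 ▸ Nat.prime_two) hHn
      (hHi.trans rfl) hunr h𝔓₀ hIr hh hhH
  have hℓw' : (ℓ : 𝓞 K) ∈ w'.asIdeal := by
    have h1 : (ℓ : 𝓞 ℚ) ∈ (w'.under (𝓞 ℚ)).asIdeal := by rw [hw'v]; exact hℓv
    rw [HeightOneSpectrum.under_asIdeal, Ideal.under_def, Ideal.mem_comap, map_natCast] at h1
    exact h1
  have hw'w : w' = w := hℓ.mem_iff.mp hℓw'
  subst hw'w; rw [hK.1] at hresτ'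
  haveI : 𝔔.IsPrime := h𝔔w.1
  set T := (absGaloisTransport (K := ℚ) (L := K)) h with hTdef
  have hTne : T.restrictNormal K ≠ 1 := by
    intro h1; apply hhH
    change h ∈ Set.range (absGaloisRestrict ℚ K)
    rw [mem_range_absGaloisRestrict_iff]; intro x
    have hx := AlgEquiv.restrictNormal_commutes T K x
    rw [h1, AlgEquiv.one_apply] at hx; exact hx.symm
  have ht : IsLiftOfAut c T.toRingEquiv := by
    have hcard : Nat.card (K ≃ₐ[ℚ] K) = 2 := by rw [IsGalois.card_aut_eq_finrank, hK.1]
    obtain ⟨y, -, hy⟩ := (Nat.card_eq_two_iff' (1 : K ≃ₐ[ℚ] K)).mp hcard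
    rw [hy c hc, ← hy _ hTne]; exact RatClosure.isLiftOfAut_restrictNormal_absGaloisTransport h
  have hτ'T : ∀ y : AlgebraicClosure K, (τ' : absoluteGaloisGroup K) • y = T (T y) := fun y ↦ by
    rw [← absGaloisTransport_absGaloisRestrict (K := ℚ) τ' y, hresτ', map_pow, pow_two,
      AlgEquiv.mul_apply]
  have hτ'fix : τ' ∈ torsionFixing (W.baseChange K) q := by
    rw [mem_torsionFixing_iff]; intro Q
    obtain ⟨P, rfl⟩ := (RatClosure.torsionEquiv (K := K) W (q : ℤ)).surjective Q
    rw [← RatClosure.torsionEquiv_smul W q τ' P, hresτ', pow_two, mul_smul, hE, hE,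
      ← mul_smul, ← pow_two, hc₀.sq_eq_one, one_smul]
  have hconjτ' : ht.conjGalCMH τ' = τ' := by
    refine AlgEquiv.ext fun y ↦ ?_
    change ht.conjGal τ' y = _
    rw [ht.conjGal_apply]
    change T.symm ((τ' : absoluteGaloisGroup K) • (T y)) = (τ' : absoluteGaloisGroup K) • y
    rw [hτ'T, hτ'T, AlgEquiv.symm_apply_apply]
  haveI : 𝔓₀.IsPrime := h𝔓₀.1
  have hh𝔓₀ : h • 𝔓₀ = 𝔓₀ := MulAction.mem_stabilizer_iff.mp hh.mem_stabilizer
  have hTint : ∀ y : AlgebraicClosure K, IsIntegral (𝓞 K) y →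
      IsIntegral (𝓞 K) (T y) ∧ IsIntegral (𝓞 K) (T.symm y) := fun y hy ↦ by
    have hyZ : IsIntegral ℤ y := isIntegral_trans (R := ℤ) (A := 𝓞 K) y hy
    exact ⟨(hyZ.map T.toRingEquiv.toRingHom.toIntAlgHom).tower_top,
      (hyZ.map T.symm.toRingEquiv.toRingHom.toIntAlgHom).tower_top⟩
  have hTmap1 : ∀ (γ : absoluteGaloisGroup ℚ) (x : absIntegers (𝓞 ℚ) ℚ),
      (absGaloisTransport (K := ℚ) (L := K)) γ (absIntegersMap ℚ K x : AlgebraicClosure K) =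
        absIntegersMap ℚ K (γ • x) := fun γ x ↦ by
    rw [coe_absIntegersMap, coe_absIntegersMap, absGaloisTransport_absClosureEmbedding,
      integralClosure.coe_smul]
  have hTmap : ∀ x : absIntegers (𝓞 ℚ) ℚ,
      T (absIntegersMap ℚ K x : AlgebraicClosure K) = absIntegersMap ℚ K (h • x) ∧
      T.symm (absIntegersMap ℚ K x : AlgebraicClosure K) = absIntegersMap ℚ K (h⁻¹ • x) := by
    intro x
    refine ⟨hTmap1 h x, ?_⟩
    have h3 := hTmap1 h (h⁻¹ • x)
    rw [smul_inv_smul] at h3; rw [← h3, ← hTdef, AlgEquiv.symm_apply_apply]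
  have hmem𝔔 : ∀ x : absIntegers (𝓞 ℚ) ℚ, absIntegersMap ℚ K x ∈ 𝔔 ↔ x ∈ 𝔓₀ := fun x ↦ by
    rw [← Ideal.mem_comap, h𝔔𝔓₀]
  have hT𝔔 : ∀ (y : absIntegers (𝓞 K) K), y ∈ 𝔔 →
      (⟨T y, (hTint y y.2).1⟩ : absIntegers (𝓞 K) K) ∈ 𝔔 ∧
      (⟨T.symm y, (hTint y y.2).2⟩ : absIntegers (𝓞 K) K) ∈ 𝔔 := by
    intro y hy
    obtain ⟨x, rfl⟩ := absIntegersMap_surjective ℚ K y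
    have hx : x ∈ 𝔓₀ := (hmem𝔔 x).mp hy
    constructor
    · have : (⟨T (absIntegersMap ℚ K x), (hTint _ (absIntegersMap ℚ K x).2).1⟩ :
          absIntegers (𝓞 K) K) = absIntegersMap ℚ K (h • x) := Subtype.ext (hTmap x).1
      rw [this, hmem𝔔, ← hh𝔓₀]
      exact Ideal.smul_mem_pointwise_smul_iff.mpr hx
    · have : (⟨T.symm (absIntegersMap ℚ K x), (hTint _ (absIntegersMap ℚ K x).2).2⟩ :
          absIntegers (𝓞 K) K) = absIntegersMap ℚ K (h⁻¹ • x) := Subtype.ext (hTmap x).2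
      rw [this, hmem𝔔, ← Ideal.mem_pointwise_smul_iff_inv_smul_mem, hh𝔓₀]
      exact hx
  have hTconj : ∀ {σ : absoluteGaloisGroup K}, σ ∈ 𝔔.inertia (absoluteGaloisGroup K) →
      (ht.conjGalCMH σ : absoluteGaloisGroup K) ∈ 𝔔.inertia (absoluteGaloisGroup K) := by
    intro σ hσ
    rw [Ideal.inertia, AddSubgroup.mem_inertia] at hσ ⊢
    intro b
    set b' : absIntegers (𝓞 K) K := ⟨T b, (hTint b b.2).1⟩ with hb'
    have h1 : σ • b' - b' ∈ 𝔔 := hσ b'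
    have h2 := (hT𝔔 _ h1).2
    have heq : (ht.conjGalCMH σ : absoluteGaloisGroup K) • b - b =
        ⟨T.symm ((σ • b' - b' : absIntegers (𝓞 K) K) : AlgebraicClosure K),
          (hTint _ (σ • b' - b').2).2⟩ := by
      apply Subtype.ext
      change (((ht.conjGalCMH σ : absoluteGaloisGroup K) • b - b : absIntegers (𝓞 K) K) :
          AlgebraicClosure K) =
        T.symm ((σ • b' - b' : absIntegers (𝓞 K) K) : AlgebraicClosure K)
      rw [AddSubgroupClass.coe_sub, AddSubgroupClass.coe_sub, integralClosure.coe_smul,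
        integralClosure.coe_smul, map_sub]
      change ht.conjGal σ b - b = T.symm (σ • T b) - T.symm (T b)
      rw [ht.conjGal_apply, AlgEquiv.symm_apply_apply]
      rfl
    rw [heq]
    exact h2
  have hTinv : ∀ ζ : AlgebraicClosure K, ζ ^ q = 1 → T.symm ζ = ζ⁻¹ := by
    intro ζ hζ
    obtain ⟨ζ₀, rfl⟩ := (absClosureEmbedding_bijective ℚ K).2 ζ
    have hζ₀ : ζ₀ ^ q = 1 := by
      apply (absClosureEmbedding_bijective ℚ K).1
      rw [map_pow, hζ, map_one]
    have h1 : T (absClosureEmbedding ℚ K ζ₀) = (absClosureEmbedding ℚ K ζ₀)⁻¹ := by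
      rw [hTdef, absGaloisTransport_absClosureEmbedding,
        smul_eq_inv_of_smul_torsion_pow_eq W Nat.prime_two hM hq hc₀ hE hζ₀, map_inv₀]
    have h2 : T (absClosureEmbedding ℚ K ζ₀)⁻¹ = absClosureEmbedding ℚ K ζ₀ := by
      rw [map_inv₀, h1, inv_inv]
    conv_lhs => rw [← h2]
    exact AlgEquiv.symm_apply_apply T _
  obtain ⟨z, hz⟩ := IsAlgClosed.exists_pow_nat_eq (algebraMap K (AlgebraicClosure K) (ℓ : K)) hqpos
  have hz0 : z ≠ 0 := by
    intro h0
    rw [h0, zero_pow hq0, eq_comm, map_eq_zero] at hz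
    exact hℓprime.ne_zero (by exact_mod_cast hz)
  have hIfix : 𝔔.inertia (absoluteGaloisGroup K) ≤ torsionFixing (W.baseChange K) q :=
    fun i hi ↦ (mem_torsionFixing_iff _ _).mpr fun P ↦
      (W.baseChange K).smul_geomTorsion_eq_of_mem_inertia hgood hqw h𝔔w hi P
  have hIμ : ∀ {σ : absoluteGaloisGroup K}, σ ∈ 𝔔.inertia (absoluteGaloisGroup K) →
      ∀ {ζ : AlgebraicClosure K}, ζ ^ q = 1 → σ • ζ = ζ := fun hσ _ hζ ↦
    InertiaTame.smul_eq_of_mem_inertia_of_pow_eq_one w hqpos hqw' h𝔔w hσ hζ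
  have hℓfix : ∀ σ : absoluteGaloisGroup K,
      σ • algebraMap K (AlgebraicClosure K) (ℓ : K) = algebraMap K (AlgebraicClosure K) (ℓ : K) :=
    fun σ ↦ by rw [absoluteGaloisGroup.smul_def, AlgEquiv.commutes]
  have hθp : ∀ σ : absoluteGaloisGroup K, (σ • z / z) ^ q = 1 := fun σ ↦
    InertiaTame.smul_div_pow_eq_one hz hz0 (hℓfix σ)
  have hinvz : ∀ {σ : absoluteGaloisGroup K}, σ ∈ 𝔔.inertia (absoluteGaloisGroup K) →
      σ⁻¹ • z = (σ • z / z)⁻¹ * z := by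
    intro σ hσ
    have h1 := InertiaTame.mul_smul_div_eq hz0 (τ := σ⁻¹) (σ' := σ) (hIμ (inv_mem hσ) (hθp σ))
    rw [inv_mul_cancel, one_smul, div_self hz0] at h1
    have h2 : σ⁻¹ • z / z = (σ • z / z)⁻¹ := eq_inv_of_mul_eq_one_left h1.symm
    rw [← h2, div_mul_cancel₀ _ hz0]
  have hTℓ : T.symm (algebraMap K (AlgebraicClosure K) (ℓ : K)) =
      algebraMap K (AlgebraicClosure K) (ℓ : K) := by
    rw [map_natCast, map_natCast]
  have hcz : ∀ {σ : absoluteGaloisGroup K}, σ ∈ 𝔔.inertia (absoluteGaloisGroup K) →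
      (ht.conjGalCMH σ : absoluteGaloisGroup K) • z = σ⁻¹ • z := by
    intro σ hσ
    have h1 := InertiaTame.ringEquiv_apply_apply_symm_root T.symm.toRingEquiv hz hz0 hTℓ
      (fun y ↦ σ • y) (fun ζ hζ y ↦ by rw [smul_mul', hIμ hσ hζ])
    rw [hinvz hσ, ← hTinv _ (hθp σ)]
    change ht.conjGal σ z = _
    rw [ht.conjGal_apply]
    exact h1
  set av : 𝔔.inertia (absoluteGaloisGroup K) → geomTorsion (W.baseChange K) q :=
    fun σ ↦ h1Eval (W.baseChange K) q d σ with hav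
  have hac : Continuous av := (continuous_h1Eval _ _ d).comp continuous_subtype_val
  have haa : ∀ σ τ, av (σ * τ) = av σ + av τ := fun σ τ ↦
    h1Eval_mul (W.baseChange K) q d (hIfix σ.2) τ
  have hd0 : ∃ σ₀ : 𝔔.inertia (absoluteGaloisGroup K),
      (((2 : ℕ) : ℤ) ^ (M - 1)) • av σ₀ ≠ 0 := by
    by_contra hall
    push Not at hall
    apply hdv
    rw [← oneCocycleClass_reprCocycle (W.baseChange K) q ((((2 : ℕ) : ℤ) ^ (M - 1)) • d)]
    refine ((W.baseChange K).oneCocycleClass_mem_selmerLocalKer_iff hgood hqw h𝔔w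
      (reprCocycle (W.baseChange K) q ((((2 : ℕ) : ℤ) ^ (M - 1)) • d))).mpr fun τ hτ ↦ ?_
    have h1 := hall ⟨τ, hτ⟩
    change h1Eval (W.baseChange K) q ((((2 : ℕ) : ℤ) ^ (M - 1)) • d) τ = 0
    rwa [h1Eval_zsmul _ _ _ _ (hIfix hτ)]
  haveI : Finite (geomTorsion (W.baseChange K) q) := Nat.finite_of_card_ne_zero (by
    rw [hcardK]; exact pow_ne_zero 2 hq0)
  obtain ⟨σ₁, -, hgen⟩ :=
    InertiaTame.exists_forall_apply_eq_nsmul w hqpos hqw' hπ hz h𝔔w hTq av hac haa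
  have hy₀a : 2 ^ (M - 1) • av σ₁ ≠ 0 := by
    obtain ⟨σ₀, hσ₀⟩ := hd0
    intro h0
    apply hσ₀
    obtain ⟨k, hk⟩ := hgen σ₀
    rw [hk, smul_comm, ← Nat.cast_pow, natCast_zsmul, h0, smul_zero]
  have hνν : ν * ν = 1 := by rcases hν with rfl | rfl <;> norm_num
  have hd_eigen : ∀ σ : 𝔔.inertia (absoluteGaloisGroup K),
      ht.torsionMap W q (av σ) = -(ν • av σ) := by
    intro σ
    have hσT : (σ : absoluteGaloisGroup K) ∈ torsionFixing (W.baseChange K) q := hIfix σ.2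
    have h1 := ht.h1Eval_conjAct W q d hσT
    rw [hd, h1Eval_zsmul _ _ _ _ hσT] at h1
    have h2 : av ⟨ht.conjGalCMH σ, hTconj σ.2⟩ =
        av ⟨(σ : absoluteGaloisGroup K)⁻¹, inv_mem σ.2⟩ :=
      InertiaTame.apply_eq_apply_of_smul_root_eq w hqpos hqw' hπ hz h𝔔w hTq av hac haa
        (hcz σ.2)
    have h3 : av ⟨(σ : absoluteGaloisGroup K)⁻¹, inv_mem σ.2⟩ = -av σ :=
      h1Eval_inv (W.baseChange K) q d hσT
    change ν • av σ = ht.torsionMap W q (av ⟨ht.conjGalCMH σ, hTconj σ.2⟩) at h1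
    rw [h2, h3, map_neg] at h1
    rw [h1, neg_neg]
  set ι := ht.torsionMap W q with hιdef
  set θq := RatClosure.torsionEquiv (K := K) W (q : ℤ) with hθq
  have hιθ : ∀ P : geomTorsion W q, ι (θq P) = θq (c₀ • P) := fun P ↦ by
    rw [← hE, ← RatClosure.torsionEquiv_smul_of_lift W ht h (fun _ ↦ rfl) q P]
  obtain ⟨ω, hω⟩ : ∃ ω : AlgebraicClosure ℚ, ω ^ 2 + ω + 1 = 0 := by
    obtain ⟨ω, hω⟩ := IsAlgClosed.exists_root
      (Polynomial.X ^ 2 + Polynomial.X + 1 : Polynomial (AlgebraicClosure ℚ))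
      (by rw [show (Polynomial.X ^ 2 + Polynomial.X + 1 : Polynomial (AlgebraicClosure ℚ)).degree
        = 2 by compute_degree!]; norm_num)
    exact ⟨ω, by simpa [Polynomial.IsRoot] using hω⟩
  have hω3 : ω ^ 3 = 1 := by
    have : ω ^ 3 - 1 = (ω - 1) * (ω ^ 2 + ω + 1) := by ring
    rw [← sub_eq_zero, this, hω, mul_zero]
  have hω0 : ω ≠ 0 := fun h0 ↦ by
    rw [h0] at hω
    norm_num at hω
  have hc₀ω : c₀ • ω = ω ^ 2 := by
    rw [RatClosure.smul_eq_inv_of_pow_eq_one hc₀ (by norm_num : (3 : ℕ) ≠ 0) hω3]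
    have : ω * ω ^ 2 = 1 := by rw [← pow_succ', hω3]
    exact inv_eq_of_mul_eq_one_right this
  have hc₀2 : c₀ * c₀ = 1 := by rw [← pow_two]; exact hc₀.sq_eq_one
  obtain ⟨θ₀, P₀', hθ₀, hθ₀semi, hP₀', hc₀P₀'⟩ : ∃ (θ₀ : geomTorsion W (q : ℤ) →+ geomTorsion W (q : ℤ))
      (P₀' : geomTorsion W (q : ℤ)), (∀ T, θ₀ (θ₀ T) + θ₀ T + T = 0) ∧
      (∀ T, c₀ • θ₀ T = θ₀ (θ₀ (c₀ • T))) ∧ addOrderOf P₀' = 2 ^ M ∧ c₀ • P₀' = P₀' := by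
    subst hq
    obtain ⟨θ₀, P₀', h1, h2, h3, h4, -, -, -, -⟩ :=
      conj_eigen_structure_twoPow (F := ℚ) W hCW hω c₀ hc₀ω hc₀2 hM
    exact ⟨θ₀, P₀', h1, h2, h3, h4⟩
  set θK : geomTorsion (W.baseChange K) q →+ geomTorsion (W.baseChange K) q :=
    θq.toAddMonoidHom.comp (θ₀.comp θq.symm.toAddMonoidHom) with hθKdef
  have hθK_apply : ∀ P : geomTorsion W q, θK (θq P) = θq (θ₀ P) := fun P ↦ by
    change θq (θ₀ (θq.symm (θq P))) = θq (θ₀ P)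
    rw [θq.symm_apply_apply]
  have hθK : ∀ T, θK (θK T) + θK T + T = 0 := fun T ↦ by
    obtain ⟨P, rfl⟩ := θq.surjective T
    rw [hθK_apply, hθK_apply, ← map_add, ← map_add, hθ₀, map_zero]
  have hιθK : ∀ T, ι (θK T) = θK (θK (ι T)) := fun T ↦ by
    obtain ⟨P, rfl⟩ := θq.surjective T
    rw [hθK_apply, hιθ, hθ₀semi, hιθ, hθK_apply, hθK_apply]
  set PK := θq P₀' with hPKdef
  have hιPK : ι PK = PK := by rw [hPKdef, hιθ, hc₀P₀']
  have hPK : addOrderOf PK = 2 ^ M := by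
    rw [hPKdef]
    have := addOrderOf_injective θq.toAddMonoidHom θq.injective P₀'
    exact this.trans hP₀'
  haveI : Finite (geomTorsion (W.baseChange K) q) := Nat.finite_of_card_ne_zero (by
    rw [hcardK]; exact pow_ne_zero 2 hq0)
  have hcard4 : Nat.card (geomTorsion (W.baseChange K) q) = 4 ^ M := by
    rw [hcardK, hq, ← pow_mul, mul_comm, pow_mul]
    norm_num
  set x := h1Eval (W.baseChange K) q s τ' with hxdef
  have hRx : e x (av σ₁) = 0 := hR 𝔔 h𝔔w τ' hτ' hτ'fix σ₁ σ₁.2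
  have hν' : -ν = 1 ∨ -ν = -1 := by rcases hν with rfl | rfl <;> norm_num
  have hdσ₁ : ι (av σ₁) = (-ν) • av σ₁ := by rw [hd_eigen σ₁, neg_zsmul]
  have h2x : (2 : ℤ) • x = 0 := by
    rw [hxdef, ← h1Eval_zsmul _ _ _ _ hτ'fix, h2s, h1Eval_zero _ _ hτ'fix]
  have hfull : ((2 : ℤ) ^ (M - 1)) • av σ₁ ≠ 0 := by
    rw [show ((2 : ℤ) ^ (M - 1)) = ((2 ^ (M - 1) : ℕ) : ℤ) by push_cast; rfl, natCast_zsmul]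
    exact hy₀a
  -- Step 8–9 at `2`: `x` is `2`-torsion and orthogonal to a full-order eigenvector, so `ι x = x`
  have hxfix : ι x = x :=
    EisensteinTorsion.tau_eq_self_of_two_torsion_of_pairing_eigen_eq_zero θK hθK ι hιθK hιPK hcard4
      hPK hM e halt hnd h2x hν' hdσ₁ hfull hRx
  -- `[c_* s, τ'] = ι [s, τ'] = [s, τ']`, so `[s − c_* s, τ'] = 0`
  set s' := s - conjAct W c (q : ℤ) s with hs'def
  have hs' : s' ∈ selmerGroup (W.baseChange K) q :=
    sub_mem hs (conjAct_mem_selmerGroup W hK.2.isComplex c _ hs)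
  have hxs' : h1Eval (W.baseChange K) q s' τ' = 0 := by
    have hsub := map_sub (h1EvalHom (W.baseChange K) (q : ℤ) hτ'fix) s (conjAct W c (q : ℤ) s)
    simp only [h1EvalHom_apply] at hsub
    rw [hs'def, hsub, ht.h1Eval_conjAct W q s hτ'fix, hconjτ', ← hιdef, ← hxdef, hxfix, sub_self]
  haveI : CharZero (w.adicCompletion K) :=
    charZero_of_injective_algebraMap (algebraMap K (w.adicCompletion K)).injective
  obtain ⟨𝔐, h𝔐⟩ := w.localPrimesAbove_nonempty
  set 𝔓w := w.primeBelow (closureEmb (K := K) (w.adicCompletion K)) 𝔐 with h𝔓wdef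
  have h𝔓w : 𝔓w ∈ w.primesAbove := HeightOneSpectrum.primeBelow_mem_primesAbove h𝔐
  obtain ⟨δ, -, hF⟩ :=
    HeightOneSpectrum.exists_isArithFrobAt_conj_of_mem_primesAbove_holds h𝔔w h𝔓w hτ'
  have hFT : δ * τ' * δ⁻¹ ∈ torsionFixing (W.baseChange K) q :=
    (torsionFixing_normal (W.baseChange K) q).conj_mem _ hτ'fix δ
  have hsunr : s' ∈ unramifiedKer (geomTorsion (W.baseChange K) q) 𝔓w :=
    selmerLocalKer_le_unramifiedKer (HeightOneSpectrum.exists_mem_inertia_apply_eq_holds w)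
      (W.baseChange K).smul_localPoints_eq_of_mem_inertia_holds hwbad hqw h𝔓w
      (((mem_selmerGroup_iff (W.baseChange K) q s').mp hs').1 w)
  have hcrit := mem_torsionLocalKer_iff_h1Eval_eq_zero (W.baseChange K) (q : ℤ) h𝔐 hF hFT
    (inertia_le_torsionFixing (W.baseChange K) hwbad hqw _ h𝔐)
    (isOpen_torsionFixing (W.baseChange K) hq0Z)
    (torsionPointsMap_bijective (W.baseChange K) (w.adicCompletion K) hq0).2 hsunr
  change s' ∈ _
  rw [hcrit, h1Eval_conj (W.baseChange K) q s' δ hτ'fix, hxs', smul_zero]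
end Summit.BirchSwinnertonDyer.BirchSwinnertonDyer.Theorems.SylvesterTwoUpper
end
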